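import Literature.NumberTheory.EllipticCurves.AnticyclotomicPrimeDecompositionAnyPrimeProofs
import Literature.NumberTheory.EllipticCurves.BigGaloisRepSelmer
import Literature.NumberTheory.EllipticCurves.ZpExtensionUnramifiedProofs
import Literature.NumberTheory.GaloisRepresentations.InertiaPadicCharacterProofs
import Literature.NumberTheory.GaloisRepresentations.LocalGaloisGroupFrobeniusProofs
import Literature.NumberTheory.GaloisRepresentations.LocalHOneInertiaRestrictionProfinite
import HarnessLib

/-!
# Crux 4 `BSDpOnCellC` (stmt-BirchSwinnertonDyer-19034), line «telescope», leaf N2 sub-leaf W3, E-side input (I-E), brick: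
# a FROBENIUS WITH NON-ZERO ANTICYCLOTOMIC IMAGE at every degree-one place `w ∤ p` of an imaginary quadratic field
# (successor LEAD `cruxlead-19034` g3; `--supports`, helper; THEOREMS ONLY)

HONEST FRAMING. No stub, no crux, no summit statement proved; BSD is proved for no curve. This is the datum the Σ-change at the bad primes
`w ∣ N` (split in `K` under the Heegner hypothesis, so of degree one) feeds to the tree's UNCONDITIONAL local term
`JetchevSkinnerWan2017.sigmaLocal_dual_of_ne_zero` (`hφ : IsFrobPow φ 1`, `hκφ : κ (localMap K (inl w) φ) = ofAdd c`, `hc : c ≠ 0`):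
Brink 2007 (tree theorem `decomp_not_le_kerSubgroup_of_isAnticyclotomic_anyPrime`: a degree-one `w ∤ p` is finitely decomposed in the
anticyclotomic tower) + «a `ℤ_p`-valued character kills the inertia at `w ∤ p`» (`apply_eq_one_of_mem_absInertia`) + «`I_w · ⟨φ⟩` is dense in
`Γ_{K_w}`» (`dense_absInertia_mul_zpowers_of_isFrobPow`) + existence of a Frobenius lift (`exists_isFrobPow_holds`).

* **`exists_isFrobPow_anticyclotomic_ne_zero`** — for `K` imaginary quadratic, `κ` anticyclotomic, `w ∤ p` of degree one: there are
  `φ ∈ Γ_{K_w}` and `c ∈ ℤ_p` with `IsFrobPow φ 1`, `κ (localMap K (inl w) φ) = ofAdd c` and `c ≠ 0`.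

References: D. Brink, *Prime decomposition in the anti-cyclotomic extension*, Math. Comp. 76 (2007), Thm. 2 and Cor. 1 [Brink2007];
J. Neukirch–A. Schmidt–K. Wingberg, *Cohomology of Number Fields*, Thm. 7.5.3 [NeukirchSchmidtWingberg2008]; L. Washington, §13 Prop. 13.2 [Washington1997].
-/

set_option autoImplicit false
set_option linter.dupNamespace false

noncomputable section

open scoped Classical Pointwise

open NumberField IsDedekindDomain Field
  Literature.NumberTheory.EllipticCurves Literature.NumberTheory.EllipticCurves.GreenbergSelmer
  Literature.NumberTheory.GaloisRepresentations
  Literature.NumberTheory.EllipticCurves.BigGaloisRep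

namespace Summit.BirchSwinnertonDyer.BirchSwinnertonDyer.Theorems.TelescopeK2FinitelyDecomposedFrobenius

/-- **A Frobenius with non-zero anticyclotomic image at a degree-one place `w ∤ p`.** See the module docstring.
[cite: Brink2007, Thm. 2 (pp. 2134–2135) and Cor. 1 (p. 2136)] [cite: NeukirchSchmidtWingberg2008, Thm. 7.5.3] [cite: Washington1997, Prop. 13.2] -/
theorem exists_isFrobPow_anticyclotomic_ne_zero {K : Type} [Field K] [NumberField K] {p : ℕ} [Fact p.Prime]
    (hK : IsImaginaryQuadratic K) (κ : ZpExtension K p) (hκ : κ.IsAnticyclotomic)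
    (w : HeightOneSpectrum (𝓞 K)) (hw : ((p : ℕ) : 𝓞 K) ∉ w.asIdeal)
    (he : w.asIdeal.ramificationIdx (𝓞 ℚ) = 1) (hf : w.asIdeal.inertiaDeg (𝓞 ℚ) = 1) :
    ∃ (φ : absoluteGaloisGroup (w.adicCompletion K)) (c : ℤ_[p]),
      IsFrobPow φ 1 ∧ κ (localMap K (Sum.inl w) φ) = Multiplicative.ofAdd c ∧ c ≠ 0 := by
  obtain ⟨φ, hφ⟩ := exists_isFrobPow_holds (F := w.adicCompletion K) 1
  refine ⟨φ, (κ (localMap K (Sum.inl w) φ)).toAdd, hφ, (ofAdd_toAdd _).symm, ?_⟩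
  intro hc
  have hBrink := Literature.NumberTheory.EllipticCurves.ZpExtension.decomp_not_le_kerSubgroup_of_isAnticyclotomic_anyPrime
    (K := K) (p := p) hK κ hκ w hw he hf
  apply hBrink
  -- `κ ∘ loc_w : Γ_{K_w} → ℤ_p` kills `I_w` (as `w ∤ p`) and `φ` (as `c = 0`), hence the dense `I_w · ⟨φ⟩`, hence everything
  set κw : absoluteGaloisGroup (w.adicCompletion K) →ₜ* Multiplicative ℤ_[p] :=
    κ.toContinuousMonoidHom.comp (localMap K (Sum.inl w)) with hκw
  have h1 : ∀ n ∈ absInertia (w.adicCompletion K), κw n = 1 := fun n hn =>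
    apply_eq_one_of_mem_absInertia (w.ringChar_residueField_adicCompletion_ne hw) κw hn
  have h2 : κw φ = 1 := by
    change κ (localMap K (Sum.inl w) φ) = 1
    rw [← ofAdd_toAdd (κ (localMap K (Sum.inl w) φ)), hc, ofAdd_zero]
  have hdense := dense_absInertia_mul_zpowers_of_isFrobPow (w.adicCompletion K) hφ
  have hsub : ((absInertia (w.adicCompletion K) : Set (absoluteGaloisGroup (w.adicCompletion K))) *
      (Subgroup.zpowers φ : Set (absoluteGaloisGroup (w.adicCompletion K)))) ⊆
      ((κw.toMonoidHom.ker : Subgroup (absoluteGaloisGroup (w.adicCompletion K))) :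
        Set (absoluteGaloisGroup (w.adicCompletion K))) := by
    rintro _ ⟨n, hn, m, hm, rfl⟩
    rw [SetLike.mem_coe, MonoidHom.mem_ker]
    change κw (n * m) = 1
    rw [map_mul, h1 n hn, one_mul]
    obtain ⟨k, rfl⟩ := Subgroup.mem_zpowers_iff.mp hm
    rw [map_zpow, h2, one_zpow]
  have hclosed : IsClosed ((κw.toMonoidHom.ker : Subgroup (absoluteGaloisGroup (w.adicCompletion K))) :
      Set (absoluteGaloisGroup (w.adicCompletion K))) :=
    (isClosed_singleton (x := (1 : Multiplicative ℤ_[p]))).preimage κw.continuous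
  have hker : ((κw.toMonoidHom.ker : Subgroup (absoluteGaloisGroup (w.adicCompletion K))) :
      Set (absoluteGaloisGroup (w.adicCompletion K))) = Set.univ := by
    rw [← hclosed.closure_eq]
    exact (hdense.mono hsub).closure_eq
  -- so `D_w = range loc_w ≤ ker κ`
  rw [← range_localMap_inl]
  rintro _ ⟨g, rfl⟩
  have hg : g ∈ ((κw.toMonoidHom.ker : Subgroup (absoluteGaloisGroup (w.adicCompletion K))) :
      Set (absoluteGaloisGroup (w.adicCompletion K))) := by rw [hker]; exact Set.mem_univ g
  have hg2 : κw g = 1 := hg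
  show _ ∈ κ.toContinuousMonoidHom.toMonoidHom.ker
  rw [MonoidHom.mem_ker]
  exact hg2

end Summit.BirchSwinnertonDyer.BirchSwinnertonDyer.Theorems.TelescopeK2FinitelyDecomposedFrobenius

end
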